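import Summits.QuantumFields.YangMills.Theorems.LuscherReductionTwistedTraceScalingMehlerForm
import HarnessLib

/-!
# (B-ST) flat Poincaré atom (B1), brick 1: SHIFTED GAUSSIAN TAILS ON `ℝ^σ` — mass, slab tail, box tail
# (lane A of S-BASE, crux `TwistedTraceScaling` stmt-QuantumFields-20203, C4-CORE, the (B-ST) pen; HANDOFF-g21 'REMAINING ANALYTIC ATOMS' (B1), hand C `…-w3`)

Elementary Gaussian bookkeeping used by the exit-mass estimates of the flat stiff pair (`…BOStiffMehlerExit`, `…BOStiffBoxBallExit`):
* ★ `integral_gaussShift` — `∫ e^{−Σ s_k(y_k−m_k)²} dy = Π_k √(π/s_k)` (`s_k > 0`; translation invariance of Lebesgue measure + ✓`integral_prod_gauss`), integrability;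
* ★ `integral_gaussShift_slab_le` — `∫_{t<|y_j−m_j|} e^{−Σ s_k(y_k−m_k)²} dy ≤ √2·e^{−(s_j/2)t²}·Π_k √(π/s_k)`: halve the `j`-th precision
  (`gaussShift_slab_pointwise`: on the slab `Σ s_k d_k² ≥ (s_j/2)t² + Σ s'_k d_k²`, `s' = s` off `j`, `s'_j = s_j/2`; `prod_sqrt_halved`);
* `setIntegral_iUnion_le_sum` — finite union bound for set integrals of a non-negative integrable function;
* ★★ `integral_gaussShift_compl_box_le` — `∫_{y ∉ m+[−t,t]^σ} e^{−Σ s_k(y_k−m_k)²} dy ≤ √2·(Σ_j e^{−(s_j/2)t²})·Π_k √(π/s_k)` (the complement of the box is the union of the `n` slabs).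
HONEST FRAMING: classical real analysis for a stub of a child of the CONDITIONAL route R2b1; (B-ST) OPEN; C4-CORE OPEN; not infinite volume, not a gap, not Clay.

## References
* G. B. Folland, *Real Analysis*, 2nd ed., Wiley 1999, §2.6 (Gaussian integrals on `ℝ^n`). [Folland1999]
-/

set_option autoImplicit false

noncomputable section

open MeasureTheory Filter
open scoped Real

namespace Summit.QuantumFields.YangMills.Theorems.FemtoTransferGap.Mehler

/-! ## §1 Shifted Gaussian: mass and coordinatewise tails -/

section GaussTail

variable {σ : Type*} [Fintype σ]

/-- ★ **Mass of a shifted Gaussian**: `∫ e^{−Σ s_k (y_k − m_k)²} dy = Π_k √(π/s_k)` (`s_k > 0`), and integrability. [folklore] -/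
theorem integral_gaussShift {s : σ → ℝ} (hs : ∀ k, 0 < s k) (m : σ → ℝ) :
    Integrable (fun y : σ → ℝ => Real.exp (-∑ k, s k * (y k - m k) ^ 2)) ∧
      ∫ y : σ → ℝ, Real.exp (-∑ k, s k * (y k - m k) ^ 2) = ∏ k, Real.sqrt (π / s k) := by
  obtain ⟨hi, he⟩ := integral_prod_gauss hs
  have e : ∀ y : σ → ℝ, Real.exp (-∑ k, s k * (y k - m k) ^ 2) = ∏ k, Real.exp (-s k * (y - m) k ^ 2) := fun y => by
    rw [← Real.exp_sum]
    congr 1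
    rw [← Finset.sum_neg_distrib]
    exact Finset.sum_congr rfl fun k _ => by simp only [Pi.sub_apply]; ring
  have e' : (fun y : σ → ℝ => Real.exp (-∑ k, s k * (y k - m k) ^ 2)) = fun y => (fun y' : σ → ℝ => ∏ k, Real.exp (-s k * y' k ^ 2)) (y - m) :=
    funext e
  rw [e']
  refine ⟨hi.comp_sub_right m, ?_⟩
  have ht := MeasureTheory.integral_sub_right_eq_self (μ := (volume : Measure (σ → ℝ))) (fun y' : σ → ℝ => ∏ k, Real.exp (-s k * y' k ^ 2)) m
  rw [ht]
  exact he

/-- Pointwise slab bound: if `s'` agrees with `s` except `s'_j = s_j/2`, then on `{t < |y_j − m_j|}`: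
`e^{−Σ s_k(y_k−m_k)²} ≤ e^{−(s_j/2)t²}·e^{−Σ s'_k(y_k−m_k)²}`. [folklore] -/
theorem gaussShift_slab_pointwise {s s' : σ → ℝ} (hs : ∀ k, 0 < s k) {j : σ} (hj : s' j = s j / 2) (hk : ∀ k, k ≠ j → s' k = s k)
    (m : σ → ℝ) {t : ℝ} (ht : 0 ≤ t) {y : σ → ℝ} (hy : t < |y j - m j|) :
    Real.exp (-∑ k, s k * (y k - m k) ^ 2) ≤ Real.exp (-(s j / 2 * t ^ 2)) * Real.exp (-∑ k, s' k * (y k - m k) ^ 2) := by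
  classical
  rw [← Real.exp_add]
  refine Real.exp_le_exp.2 ?_
  have hdiff : ∑ k, s k * (y k - m k) ^ 2 - ∑ k, s' k * (y k - m k) ^ 2 = s j / 2 * (y j - m j) ^ 2 := by
    rw [← Finset.sum_sub_distrib]
    have e : ∀ k ∈ (Finset.univ : Finset σ), s k * (y k - m k) ^ 2 - s' k * (y k - m k) ^ 2 = if k = j then s j / 2 * (y j - m j) ^ 2 else 0 :=
      fun k _ => by
        by_cases hkj : k = j
        · rw [if_pos hkj, hkj, hj]; ring
        · rw [if_neg hkj, hk k hkj]; ring
    rw [Finset.sum_congr rfl e, Finset.sum_ite_eq' Finset.univ j, if_pos (Finset.mem_univ j)]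
  have h2 : t ^ 2 ≤ (y j - m j) ^ 2 := by
    rw [← sq_abs (y j - m j)]; exact pow_le_pow_left₀ ht (le_of_lt hy) 2
  have h3 : s j / 2 * t ^ 2 ≤ s j / 2 * (y j - m j) ^ 2 := mul_le_mul_of_nonneg_left h2 (half_pos (hs j)).le
  linarith

/-- The Gaussian mass with one precision halved: `Π_k √(π/s'_k) = √2·Π_k √(π/s_k)`. [folklore] -/
theorem prod_sqrt_halved {s s' : σ → ℝ} {j : σ} (hj : s' j = s j / 2) (hk : ∀ k, k ≠ j → s' k = s k) :
    ∏ k, Real.sqrt (π / s' k) = Real.sqrt 2 * ∏ k, Real.sqrt (π / s k) := by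
  classical
  have e : ∀ k ∈ (Finset.univ : Finset σ), Real.sqrt (π / s' k) = (if k = j then Real.sqrt 2 else 1) * Real.sqrt (π / s k) := fun k _ => by
    by_cases hkj : k = j
    · rw [if_pos hkj, hkj, hj, ← Real.sqrt_mul (by norm_num : (0 : ℝ) ≤ 2)]
      congr 1; ring
    · rw [if_neg hkj, hk k hkj, one_mul]
  rw [Finset.prod_congr rfl e, Finset.prod_mul_distrib, Finset.prod_ite_eq' Finset.univ j, if_pos (Finset.mem_univ j)]

omit [Fintype σ] in
/-- The slab `{t < |y_j − m_j|}` is measurable. [folklore] -/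
theorem measurableSet_slab (m : σ → ℝ) (t : ℝ) (j : σ) : MeasurableSet {y : σ → ℝ | t < |y j - m j|} :=
  measurableSet_lt measurable_const ((measurable_pi_apply j).sub measurable_const).abs

/-- ★ **Slab tail**: `∫_{t < |y_j − m_j|} e^{−Σ s_k(y_k − m_k)²} dy ≤ √2·e^{−(s_j/2)t²}·Π_k √(π/s_k)`. [folklore] -/
theorem integral_gaussShift_slab_le {s : σ → ℝ} (hs : ∀ k, 0 < s k) (m : σ → ℝ) {t : ℝ} (ht : 0 ≤ t) (j : σ) :
    ∫ y in {y : σ → ℝ | t < |y j - m j|}, Real.exp (-∑ k, s k * (y k - m k) ^ 2) ≤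
      Real.sqrt 2 * Real.exp (-(s j / 2 * t ^ 2)) * ∏ k, Real.sqrt (π / s k) := by
  classical
  -- halve the precision in the `j`-th coordinate
  obtain ⟨s', hj, hk⟩ : ∃ s' : σ → ℝ, s' j = s j / 2 ∧ ∀ k, k ≠ j → s' k = s k :=
    ⟨Function.update s j (s j / 2), Function.update_self _ _ _, fun k hkj => Function.update_of_ne hkj _ _⟩
  have hs' : ∀ k, 0 < s' k := fun k => by
    by_cases hkj : k = j
    · rw [hkj, hj]; exact half_pos (hs j)
    · rw [hk k hkj]; exact hs k
  obtain ⟨hi', he'⟩ := integral_gaussShift hs' m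
  obtain ⟨hi, -⟩ := integral_gaussShift hs m
  have step1 : ∫ y in {y : σ → ℝ | t < |y j - m j|}, Real.exp (-∑ k, s k * (y k - m k) ^ 2) ≤
      ∫ y in {y : σ → ℝ | t < |y j - m j|}, Real.exp (-(s j / 2 * t ^ 2)) * Real.exp (-∑ k, s' k * (y k - m k) ^ 2) :=
    setIntegral_mono_on hi.integrableOn (hi'.const_mul _).integrableOn (measurableSet_slab m t j)
      fun y hy => gaussShift_slab_pointwise hs hj hk m ht hy
  have step2 : ∫ y in {y : σ → ℝ | t < |y j - m j|}, Real.exp (-(s j / 2 * t ^ 2)) * Real.exp (-∑ k, s' k * (y k - m k) ^ 2) ≤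
      ∫ y : σ → ℝ, Real.exp (-(s j / 2 * t ^ 2)) * Real.exp (-∑ k, s' k * (y k - m k) ^ 2) :=
    setIntegral_le_integral (hi'.const_mul _) (ae_of_all _ fun y => mul_nonneg (Real.exp_pos _).le (Real.exp_pos _).le)
  have step3 : ∫ y : σ → ℝ, Real.exp (-(s j / 2 * t ^ 2)) * Real.exp (-∑ k, s' k * (y k - m k) ^ 2) =
      Real.sqrt 2 * Real.exp (-(s j / 2 * t ^ 2)) * ∏ k, Real.sqrt (π / s k) := by
    rw [integral_const_mul, he', prod_sqrt_halved hj hk]; ring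
  exact (step1.trans step2).trans_eq step3

/-- A finite union bound for set integrals of a non-negative integrable function. [folklore] -/
theorem setIntegral_iUnion_le_sum {X : Type*} [MeasurableSpace X] {μ : Measure X} {A : σ → Set X} (hA : ∀ i, MeasurableSet (A i)) {f : X → ℝ}
    (hf0 : ∀ x, 0 ≤ f x) (hfi : Integrable f μ) : ∫ x in ⋃ i, A i, f x ∂μ ≤ ∑ i, ∫ x in A i, f x ∂μ := by
  rw [← integral_indicator (MeasurableSet.iUnion hA)]
  have e : ∑ i, ∫ x in A i, f x ∂μ = ∫ x, ∑ i, (A i).indicator f x ∂μ := by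
    rw [integral_finsetSum _ fun i _ => hfi.indicator (hA i)]
    exact Finset.sum_congr rfl fun i _ => (integral_indicator (hA i)).symm
  rw [e]
  refine integral_mono (hfi.indicator (MeasurableSet.iUnion hA)) (integrable_finsetSum _ fun i _ => hfi.indicator (hA i)) fun x => ?_
  dsimp only
  by_cases hx : x ∈ ⋃ i, A i
  · rw [Set.indicator_of_mem hx]
    obtain ⟨i, hi⟩ := Set.mem_iUnion.1 hx
    calc f x = (A i).indicator f x := by rw [Set.indicator_of_mem hi]
      _ ≤ ∑ i, (A i).indicator f x :=
          Finset.single_le_sum (f := fun i => (A i).indicator f x) (fun k _ => Set.indicator_nonneg (fun y _ => hf0 y) x) (Finset.mem_univ i)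
  · rw [Set.indicator_of_notMem hx]
    exact Finset.sum_nonneg fun i _ => Set.indicator_nonneg (fun y _ => hf0 y) x

/-- ★★ **Box tail**: `∫_{y ∉ m + [−t,t]^σ} e^{−Σ s_k(y_k − m_k)²} dy ≤ √2·(Σ_j e^{−(s_j/2)t²})·Π_k √(π/s_k)`. [folklore] -/
theorem integral_gaussShift_compl_box_le {s : σ → ℝ} (hs : ∀ k, 0 < s k) (m : σ → ℝ) {t : ℝ} (ht : 0 ≤ t) :
    ∫ y in {y : σ → ℝ | ∀ k, |y k - m k| ≤ t}ᶜ, Real.exp (-∑ k, s k * (y k - m k) ^ 2) ≤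
      Real.sqrt 2 * (∑ j, Real.exp (-(s j / 2 * t ^ 2))) * ∏ k, Real.sqrt (π / s k) := by
  have hU : {y : σ → ℝ | ∀ k, |y k - m k| ≤ t}ᶜ = ⋃ j, {y : σ → ℝ | t < |y j - m j|} := by
    ext y; simp only [Set.mem_compl_iff, Set.mem_setOf_eq, not_forall, not_le, Set.mem_iUnion]
  rw [hU]
  obtain ⟨hi, -⟩ := integral_gaussShift hs m
  refine (setIntegral_iUnion_le_sum (fun j => measurableSet_slab m t j) (fun y => (Real.exp_pos _).le) hi).trans ?_
  rw [Finset.mul_sum, Finset.sum_mul]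
  exact Finset.sum_le_sum fun j _ => integral_gaussShift_slab_le hs m ht j

end GaussTail

end Summit.QuantumFields.YangMills.Theorems.FemtoTransferGap.Mehler

end
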